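import Mathlib
import Summits.NavierStokesRegularity.NavierStokesRegularity.Theses.RootDecompLitSlice
import Summits.NavierStokesRegularity.NavierStokesRegularity.Theorems.CertifiedBlowupCertifiedBlowupAxisymBlowupEnergyDrain
import Summits.NavierStokesRegularity.NavierStokesRegularity.Theorems.EulerZoomLiouvillePowerGaugeEulerLiouvilleBackwardTools
import HarnessLib

/-!
# Route RootDecompLitSlice — support STg `GeneralWindowTradeoff` ⟨stmt-NavierStokesRegularity-27390⟩:
  the registered stub (M) `stub_windowHardyEnergy` of the skeleton `free_window` REDUCED TO HARDY'S
  INEQUALITY ON BALLS OF `ℝ³`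

The load-bearing stub (M) of `free_window` (skeleton sha256 ab1b91173537) says: on the classical
Leray–Hopf frame, if `∫|u(t) − u(T)|² ≤ H` on the window `t ∈ [T−τ, T)`, then
`∫_{B_r(x₀)}|u(T)|² ≤ 2H + (4r²/(ντ))·(‖u(T−τ)‖₂² − ‖u(T)‖₂²)`. Its proof plan has four steps:
(i) Hardy on `ℝ³`, `∫_{B_r(x₀)}|f|² ≤ 4r²‖∇f‖₂²`; (ii) the windowed dissipation is paid by the energy
drop, `2ν∫_{T−τ}^{T}‖∇u‖₂² ≤ ‖u(T−τ)‖₂² − ‖u(T)‖₂²`; (iii) mean value in time; (iv) the triangle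
inequality in `L²(B_r(x₀))`.

THIS FILE proves (ii)–(iv) and the assembly, sorry-free, leaving (i) as an explicit hypothesis in its
weakest useful form — Hardy's inequality with constant `4` on balls for `C¹ ∩ L²` fields of `ℝ³`,
in `[0, ∞]`-valued form (trivial when `∇f ∉ L²`):

  `hardyBall : ∀ f, ContDiff ℝ 1 f → MemLp f 2 → ∀ x₀ r, 0 < r →
     ∫⁻_{B_r(x₀)} ‖f‖ₑ² ≤ ofReal (4r²) · ∫⁻ ofReal |Df|²_F`

(classical: `∫|f|²/|y−x₀|² ≤ 4∫|∇f|²` on `H¹(ℝ³)` — Hardy 1920 / Leray 1934 (1.14); the tree holds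
the exterior-of-a-ball `C¹_c` version `Literature.Analysis.Calculus.hardy_sq_integral_exterior_le`, from
which `hardyBall` follows by `R → 0` and a cut-off at infinity — NOT done here).

* `windowHardyEnergy_of_hardyBall : hardyBall → (stub (M) signature, verbatim)`.
  Step (ii) is the landed `CertifiedBlowupAxisymBlowup.EnergyDrain.dissipation_le_energy_sub`
  (finiteness + `ν·D ≤ E(u(T−τ)) − E(u(T))`); step (iii) by contradiction through
  `setLIntegral_mono'` on `(T−τ, T)` (no time-measurability of the enstrophy needed): for every
  `δ > 0` some slice `s ∈ (T−τ, T)` has `∫⁻|∇u(s)|² < (drop)/(2ντ) + δ`; step (iv) with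
  `eLpNorm_add_le` on `volume.restrict (ball x₀ r)` and `(a + b)² ≤ 2a² + 2b²`; the `δ` is removed by
  `le_of_forall_pos_le_add`.

HONEST FRAMING: a CONDITIONAL reduction of a registered stub of a SUPPORT item (route-internal glue
below ST ⟨31791⟩); it closes nothing by itself — with `hardyBall` proved, (M) and hence STg
(`GeneralWindowTradeoff_of` of the skeleton, stub (S) landed p829238) close. Nothing here bears on NS
regularity (rung 0). Lands `--supports stmt-NavierStokesRegularity-27390 --as helper` (decomp-ns
route-writer g36). [folklore]
-/

set_option linter.dupNamespace false

noncomputable section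

open MeasureTheory Set Metric
open scoped ENNReal NNReal
open Literature.Analysis.FluidPDE

namespace Summit.NavierStokesRegularity.NavierStokesRegularity.Theorems.GeneralWindowTradeoff

namespace WindowReduction

/-- `(√a + √b)² ≤ 2a + 2b` for `a, b ≥ 0`. [folklore] -/
theorem sq_sqrt_add_sqrt_le {a b : ℝ} (ha : 0 ≤ a) (hb : 0 ≤ b) :
    (Real.sqrt a + Real.sqrt b) ^ 2 ≤ 2 * a + 2 * b := by
  have h1 := Real.sq_sqrt ha
  have h2 := Real.sq_sqrt hb
  nlinarith [sq_nonneg (Real.sqrt a - Real.sqrt b)]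

/-- The real set integral `∫_{B} ‖f‖²` of an `L²` field is the real part of `∫⁻_{B} ‖f‖ₑ²`. [folklore] -/
theorem setIntegral_norm_sq_eq_toReal (f : EuclideanSpace ℝ (Fin 3) → EuclideanSpace ℝ (Fin 3))
    (hf : MemLp f 2 volume) (B : Set (EuclideanSpace ℝ (Fin 3))) :
    ∫ x in B, ‖f x‖ ^ 2 = (∫⁻ x in B, ‖f x‖ₑ ^ 2).toReal := by
  have hint : Integrable (fun x => ‖f x‖ ^ 2) (volume.restrict B) :=
    (hf.integrable_norm_pow two_ne_zero).restrict
  rw [integral_eq_lintegral_of_nonneg_ae (Filter.Eventually.of_forall fun _ => sq_nonneg _)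
    hint.aestronglyMeasurable]
  congr 1
  refine lintegral_congr fun x => ?_
  rw [← ofReal_norm, ENNReal.ofReal_pow (norm_nonneg _)]

/-- MEAN VALUE IN TIME WITHOUT MEASURABILITY: if `∫⁻_{(a,b)} F ≤ ofReal C` with `a < b`, then for
every `δ > 0` some `s ∈ (a, b)` has `F s < ofReal (C/(b−a) + δ)`. [folklore] -/
theorem exists_slice_lt {F : ℝ → ℝ≥0∞} {a b C δ : ℝ} (hab : a < b) (hC : 0 ≤ C) (hδ : 0 < δ)
    (hF : ∫⁻ s in Ioo a b, F s ≤ ENNReal.ofReal C) :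
    ∃ s ∈ Ioo a b, F s < ENNReal.ofReal (C / (b - a) + δ) := by
  by_contra hcon
  push Not at hcon
  have hlen : 0 < b - a := sub_pos.2 hab
  have h1 : ∫⁻ _ in Ioo a b, ENNReal.ofReal (C / (b - a) + δ) ≤ ∫⁻ s in Ioo a b, F s :=
    setLIntegral_mono' measurableSet_Ioo fun s hs => hcon s hs
  rw [setLIntegral_const, Real.volume_Ioo, ← ENNReal.ofReal_mul (by positivity)] at h1
  have h2 : (C / (b - a) + δ) * (b - a) = C + δ * (b - a) := by
    field_simp
  rw [h2] at h1
  have h3 : C + δ * (b - a) ≤ C := ENNReal.ofReal_le_ofReal_iff hC |>.1 (h1.trans hF)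
  nlinarith

end WindowReduction

open WindowReduction in
/-- **Stub (M) `stub_windowHardyEnergy` of `free_window` REDUCED TO HARDY ON BALLS.** Given Hardy's
inequality with constant `4` on balls for `C¹ ∩ L²` fields of `ℝ³` (`[0,∞]`-valued form), the
registered stub (M) holds verbatim: on the classical Leray–Hopf frame, a window modulus
`∫|u(t) − u(T)|² ≤ H` for `t ∈ [T−τ, T)` gives
`∫_{B_r(x₀)}|u(T)|² ≤ 2H + (4r²/(ντ))·(‖u(T−τ)‖₂² − ‖u(T)‖₂²)`. [folklore] -/
theorem windowHardyEnergy_of_hardyBall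
    (hardyBall : ∀ (f : EuclideanSpace ℝ (Fin 3) → EuclideanSpace ℝ (Fin 3)),
      ContDiff ℝ 1 f → MemLp f 2 volume → ∀ (x₀ : EuclideanSpace ℝ (Fin 3)) (r : ℝ), 0 < r →
        ∫⁻ y in ball x₀ r, ‖f y‖ₑ ^ 2 ≤
          ENNReal.ofReal (4 * r ^ 2) * ∫⁻ y, ENNReal.ofReal (frobeniusNormSq (fderiv ℝ f y))) :
    ∀ (ν T : ℝ), 0 < ν → 0 < T →
    ∀ (u : ℝ → EuclideanSpace ℝ (Fin 3) → EuclideanSpace ℝ (Fin 3))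
      (p : ℝ → EuclideanSpace ℝ (Fin 3) → ℝ),
      Literature.Analysis.FluidPDE.IsClassicalNSSolutionOn (Set.Ico 0 T) ν 0 u p →
      Literature.Analysis.FluidPDE.IsLerayHopfOn T ν 0 (u 0) u →
      Literature.Analysis.FluidPDE.HasRapidSpatialDecay (u 0) →
      ∀ (x₀ : EuclideanSpace ℝ (Fin 3)) (r τ H : ℝ), 0 < r → 0 < τ → τ < T → 0 ≤ H →
        (∀ t ∈ Set.Ico (T - τ) T, ∫⁻ x, ‖u t x - u T x‖ₑ ^ 2 ≤ ENNReal.ofReal H) →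
        ∫ x in Metric.ball x₀ r, ‖u T x‖ ^ 2 ≤
          2 * H + 4 * (r ^ 2 / (ν * τ)) * ((∫ x, ‖u (T - τ) x‖ ^ 2) - ∫ x, ‖u T x‖ ^ 2) := by
  intro ν T hν hT u p hcl hLH _hdec x₀ r τ H hr hτ hτT hH hmod
  -- the window `(T − τ, T)` and the energy drop `Δ`
  have h1pos : 0 < T - τ := by linarith
  set Δ : ℝ := (∫ x, ‖u (T - τ) x‖ ^ 2) - ∫ x, ‖u T x‖ ^ 2 with hΔ_def
  set F : ℝ → ℝ≥0∞ := fun s => ∫⁻ x, ENNReal.ofReal (frobeniusNormSq (fderiv ℝ (u s) x)) with hF_def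
  -- (ii) windowed dissipation ≤ energy drop (landed `EnergyDrain.dissipation_le_energy_sub`)
  obtain ⟨hDfin, hDle⟩ := CertifiedBlowupAxisymBlowup.EnergyDrain.dissipation_le_energy_sub hν hcl hLH
    (t₁ := T - τ) (t₂ := T) h1pos.le (by linarith) le_rfl
  have hKE : VectorCalculus.kineticEnergy (u (T - τ)) - VectorCalculus.kineticEnergy (u T) = Δ / 2 := by
    simp only [VectorCalculus.kineticEnergy, hΔ_def]; ring
  rw [hKE] at hDle
  have hD0 : 0 ≤ ν * (∫⁻ s in Ioo (T - τ) T, F s).toReal := by positivity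
  have hΔ0 : 0 ≤ Δ := by linarith
  have hDle' : ∫⁻ s in Ioo (T - τ) T, F s ≤ ENNReal.ofReal (Δ / (2 * ν)) := by
    rw [← ENNReal.ofReal_toReal hDfin]
    refine ENNReal.ofReal_le_ofReal ?_
    rw [le_div_iff₀ (by positivity)]
    linarith
  -- memberships
  have hmT : MemLp (u T) 2 volume := hLH.memLp T ⟨hT.le, le_rfl⟩
  -- remove `δ`
  refine le_of_forall_pos_le_add fun ε hε => ?_
  set δ : ℝ := ε / (8 * r ^ 2) with hδ_def
  have hδ : 0 < δ := by positivity
  -- (iii) a slice with small enstrophy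
  obtain ⟨s, hs, hFs⟩ := exists_slice_lt (F := F) (by linarith : T - τ < T) (by positivity : 0 ≤ Δ / (2 * ν))
    hδ hDle'
  have hwin : T - (T - τ) = τ := by ring
  rw [hwin] at hFs
  have hs0T : s ∈ Ico 0 T := ⟨(h1pos.trans hs.1).le, hs.2⟩
  have hms : MemLp (u s) 2 volume := hLH.memLp s ⟨hs0T.1, hs.2.le⟩
  have hC1 : ContDiff ℝ 1 (u s) := (hcl.contDiff_velocity hs0T).of_le (by exact_mod_cast le_top)
  -- (i) Hardy at the slice `s`
  set Bval : ℝ := 4 * r ^ 2 * (Δ / (2 * ν) / τ + δ) with hB_def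
  have hBval0 : 0 ≤ Bval := by positivity
  have hHardy : ∫⁻ y in ball x₀ r, ‖u s y‖ₑ ^ 2 ≤ ENNReal.ofReal Bval := by
    refine (hardyBall (u s) hC1 hms x₀ r hr).trans ?_
    rw [hB_def, ENNReal.ofReal_mul (by positivity : (0 : ℝ) ≤ 4 * r ^ 2)]
    gcongr
  -- (iv) triangle inequality in `L²(B_r(x₀))`
  set μB : Measure (EuclideanSpace ℝ (Fin 3)) := volume.restrict (ball x₀ r) with hμB
  have htri : eLpNorm (u T) 2 μB ≤ eLpNorm (u T - u s) 2 μB + eLpNorm (u s) 2 μB := by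
    have h := eLpNorm_add_le (hmT.1.restrict.sub hms.1.restrict) hms.1.restrict (p := 2)
      (by norm_num) (μ := μB)
    simpa only [sub_add_cancel] using h
  have hmodB : eLpNorm (u T - u s) 2 μB ≤ ENNReal.ofReal (Real.sqrt H) := by
    rw [PowerGaugeEulerLiouville.Backward.eLpNorm_two_eq_sqrt, Real.sqrt_eq_rpow,
      ← ENNReal.ofReal_rpow_of_nonneg hH (by norm_num)]
    refine ENNReal.rpow_le_rpow ?_ (by norm_num)
    calc ∫⁻ y, ‖(u T - u s) y‖ₑ ^ 2 ∂μB ≤ ∫⁻ y, ‖(u T - u s) y‖ₑ ^ 2 :=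
          lintegral_mono' Measure.restrict_le_self le_rfl
      _ = ∫⁻ y, ‖u s y - u T y‖ₑ ^ 2 := by
          refine lintegral_congr fun y => ?_
          rw [Pi.sub_apply, ← enorm_neg, neg_sub]
      _ ≤ ENNReal.ofReal H := hmod s ⟨hs.1.le, hs.2⟩
  have hsB : eLpNorm (u s) 2 μB ≤ ENNReal.ofReal (Real.sqrt Bval) := by
    rw [PowerGaugeEulerLiouville.Backward.eLpNorm_two_eq_sqrt, Real.sqrt_eq_rpow,
      ← ENNReal.ofReal_rpow_of_nonneg hBval0 (by norm_num)]
    exact ENNReal.rpow_le_rpow hHardy (by norm_num)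
  have hsum : eLpNorm (u T) 2 μB ≤ ENNReal.ofReal (Real.sqrt H + Real.sqrt Bval) := by
    rw [ENNReal.ofReal_add (Real.sqrt_nonneg _) (Real.sqrt_nonneg _)]
    exact htri.trans (add_le_add hmodB hsB)
  have hsq : ∫⁻ y, ‖u T y‖ₑ ^ 2 ∂μB ≤ ENNReal.ofReal ((Real.sqrt H + Real.sqrt Bval) ^ 2) := by
    have h := PowerGaugeEulerLiouville.Backward.lintegral_enorm_sq_le_of_eLpNorm_le hsum
    rwa [← ENNReal.ofReal_pow (add_nonneg (Real.sqrt_nonneg _) (Real.sqrt_nonneg _))] at h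
  -- back to the real set integral
  have hfinal : ∫ x in ball x₀ r, ‖u T x‖ ^ 2 ≤ (Real.sqrt H + Real.sqrt Bval) ^ 2 := by
    rw [setIntegral_norm_sq_eq_toReal (u T) hmT (ball x₀ r)]
    exact ENNReal.toReal_le_of_le_ofReal (sq_nonneg _) hsq
  calc ∫ x in ball x₀ r, ‖u T x‖ ^ 2 ≤ (Real.sqrt H + Real.sqrt Bval) ^ 2 := hfinal
    _ ≤ 2 * H + 2 * Bval := sq_sqrt_add_sqrt_le hH hBval0
    _ = 2 * H + 4 * (r ^ 2 / (ν * τ)) * Δ + ε := by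
        rw [hB_def, hδ_def]
        field_simp
        ring

end Summit.NavierStokesRegularity.NavierStokesRegularity.Theorems.GeneralWindowTradeoff
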